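import Literature.Probability.FitznerVanDerHofstad2017.WbxCellD10EnvO
import HarnessLib

/-!
# `WBX(16)` ⊕ far-node cell at `d := 10`, (o)-envelope point — the bubble LEVELS `m = 4, 5, 6` (and generic `3 ≤ m`)

PACKET. b2b-lace packet, CARVER seat gen 34 (unit `b2b-lace-carver-g34`).  HOME/LEMMAS node D10-WBXCELL-O (`carver-g34:claim1`), ADDENDUM
module: the landed assembly `WbxCellD10EnvO` instantiates the cell theorem at the bubble level `m = 3`
(`Σ'_y ‖y‖₂² P_p({0 ⟷_{≥3} y} □ {y ⟷ 0})`); the composite Stage-1 cell reads the weighted repulsive bubble at the levels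
`k = 3, 4, 5, 6` ([NoBLE17] §5.3.1 (5.36)–(5.38): `Bound[WeightedBubble,k,·]`, notebook cells 13–15; tree `NoGoFrameWBX`: `wb3 … wb6`).
Since `{0 ⟷_{≥m} y} ⊆ {0 ⟷_{≥3} y}` is not the route taken (the per-order pieces start at `i = m`), this module re-instantiates
the landed `toReal_tsum_sq_weighted_repBubble_le_orderXBounds` at a GENERIC level `3 ≤ m` with the SAME kernel-certified
per-order bounds `qO i` (`hqO` restricted to `Icc m 16`) — `toReal_tsum_sq_weighted_repBubble_le_envelopeO_level` — and folds the
finite sums `Σ_{i=m}^{16} zO^i · qO i ≤ QO4 / QO5 / QO6` (exact rational arithmetic, `norm_num`) for `m = 4, 5, 6`.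
No new kernel `decide`; additive; imports the landed assembly only.

CITATION HEADER (PLACEMENT v2). Part of a certified REPRODUCTION of R. Fitzner, R. van der Hofstad, *Generalized approach to the
non-backtracking lace expansion*, PTRF **169** (2017) 1041–1119 [NoBLE17] — §5.3.1 (5.36)–(5.38) and §5.3.3 p. 1098 (the weighted
repulsive bubble at level `m` bounded by the explicit terms `i = m … M` plus a far node), (5.14) p. 1092 — and of R. Fitzner, R. van der
Hofstad, *Mean-field behavior for nearest-neighbor percolation in `d > 10`*, EJP **22** (2017) no. 43 [FvdH17], §4.2 (4.18), with
N. Madras, G. Slade, *The Self-Avoiding Walk* (1993) [MS93], Cor. 5.3.2 (5.3.3):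

> [NoBLE17] p. 1098: "we compute the contributions … explicitly, using the number of `n`-step SAWs … for all `x` with `‖x‖₁ ≤ n`".

Every `[cite:]` tag below is a LOCATOR for comparison, not an appeal to authority: every statement is proved here from the landed
assembly `WbxCellD10EnvO` (carver-g34) and the landed kernel `WbxCellExactKernel` (lean1-g22 p227060).

LANE. What-if / input-certification: arithmetic at FIXED rational numerals (`d := 10`, cut `44`, `z̄ = 2031/38000`, `ḡ = 119/100`,
far value `tabHi 1 44`); no certificate of record, tuple of record, frame table or `d = 11` module is touched; no `…Of 10` /
`MeanFieldD10*` structure is instantiated; no engine number is read; no statement about percolation in any dimension is made.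

## Values (folded literals, 40-digit outward decimals; exact rationals in HOME `carver/g34/cell/cell_envO_levels_d10.json`)

- `m = 4`: `Σ_{i=4}^{16} zO^i qO i` = 1.317869209907842e-02 ≤ `QO4` = 1317869209907842190765988050667740906743/10^41
- `m = 5`: `Σ_{i=5}^{16} zO^i qO i` = 9.656796358633002e-03 ≤ `QO5` = 9656796358633002227267894227259045892265/10^42
- `m = 6`: `Σ_{i=6}^{16} zO^i qO i` = 7.400266779496570e-03 ≤ `QO6` = 7400266779496569638824329779968453618045/10^42
- (`m = 3`: `QO` of `WbxCellD10EnvO` = 2046749702598186688096909600913687020990/10^41.)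
-/

set_option Elab.async false

namespace Literature.Probability.FitznerVanDerHofstad2017

open Finset
open Literature.Barriers.CriticalPhenomena Literature.Probability.Percolation
open Literature.Probability.LatticeModels
open scoped BigOperators ENNReal

namespace WbxCellD10

/-- `hq` of the cell theorem at a generic level: `∀ i ∈ Icc m 16, wbxOrderXQ 10 i 44 zO gO I44 ≤ qO i` for `3 ≤ m` (restriction of `hqO`). [cite: FitznerVanDerHofstad2016NoBLE, §5.3.3 p. 1098] -/
theorem hqO_level {m : ℕ} (hm : 3 ≤ m) : ∀ i ∈ Icc m 16, wbxOrderXQ 10 i 44 zO gO I44 ≤ qO i := by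
  intro i hi
  rw [mem_Icc] at hi
  exact hqO i (by rw [mem_Icc]; omega)

/-- **The `WBX(16)` ⊕ far-node cell at `d := 10`, (o)-envelope point, generic bubble level `3 ≤ m` (for `m > 16` the finite sum is empty).**  For interior `p` with
`p ≤ zO`, far cell `𝒮 k = (1, 17, {0})`, `c > 0`, `f_i(p) ≤ γ_i`, `γ 1 ≤ 119/100`:
`Σ'_y ‖y‖₂² P_p({0 ⟷_{≥m} y} □ {y ⟷ 0}) ≤ Σ_{i=m}^{16} zO^i · qO i + (20 zO)^17 · γ 2 · c k` with the kernel-certified `qO` of the landed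
assembly.  Pointer language: an input-certification instance of `toReal_tsum_sq_weighted_repBubble_le_orderXBounds`; no statement about any
dimension beyond the displayed inequality at `d := 10`.
[cite: FitznerVanDerHofstad2016NoBLE, §5.3.1 (5.36)–(5.38) with §5.3.3 p. 1098; (5.14) p. 1092]
[cite: FitznerVanDerHofstad2017, §4.2 (4.18)]
[cite: MadrasSlade1993, Cor. 5.3.2 (5.3.3) (reprint PDF p. 148)] -/
theorem toReal_tsum_sq_weighted_repBubble_le_envelopeO_level {ι : Type*} [Fintype ι] [Nonempty ι]
    {m : ℕ} (hm : 3 ≤ m)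
    {p : unitInterval} (hp : p ∈ Set.Ioo (nbwThresholdI 10) (criticalProbI 10))
    {𝒮 : ι → ℕ × ℕ × Set (Site 10)} {cμ : ℝ} {c : ι → ℝ} (hc : ∀ k, 0 < c k)
    {γ : Fin 3 → ℚ} (hΓ : ∀ i, nobleFOf 𝒮 cμ c i p ≤ (γ i : ℝ)) (hγ : γ 1 ≤ 119 / 100)
    {k : ι} (hk : 𝒮 k = (1, 17, {(0 : Site 10)})) (hpz : (p : ℝ) ≤ ((zO : ℚ) : ℝ)) :
    (∑' y : Site 10, ENNReal.ofReal (euclidNorm y ^ 2) *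
        bondPercolation (zdGraph 10) p (openConnGe m (0 : Site 10) y □ openConn y 0)).toReal ≤
      (∑ i ∈ Icc m 16, ((zO : ℚ) : ℝ) ^ i * ((qO i : ℚ) : ℝ)) + (2 * 10 * ((zO : ℚ) : ℝ)) ^ 17 * ((γ 2 : ℝ) * c k) := by
  have hΓ' : ∀ i, nobleFOf 𝒮 cμ c i p ≤ ((![γ 0, gO, γ 2] : Fin 3 → ℚ) i : ℝ) := by
    intro i
    fin_cases i
    · exact hΓ 0
    · exact (hΓ 1).trans (by exact_mod_cast hγ)
    · exact hΓ 2
  have h := toReal_tsum_sq_weighted_repBubble_le_orderXBounds (d := 10) (ι := ι) (by norm_num) hp m 16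
    (J := fun _ => 22) (fun i hi => by rw [mem_Icc] at hi; omega) hc hΓ' hk hpz (I := fun _ => I44)
    (fun _ _ => srwI_le_I44) (q := qO) (fun i hi => hqO_level hm i hi)
  refine h.trans ?_
  have h3 : (((![γ 0, gO, γ 2] : Fin 3 → ℚ) 2 : ℚ) : ℝ) = ((γ 2 : ℚ) : ℝ) := by rfl
  rw [h3]
  exact add_le_add le_rfl (le_of_eq (by norm_num))

/-- The folded literal `QO4 ≥ Σ_{i=4}^{16} zO^i · qO i`. [cite: FitznerVanDerHofstad2016NoBLE, §5.3.1 (5.36)–(5.38)] -/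
def QO4 : ℚ := 1317869209907842190765988050667740906743 / 100000000000000000000000000000000000000000

/-- `Σ_{i ∈ Icc 4 16} zO^i · qO i ≤ QO4` (exact rational arithmetic). [cite: FitznerVanDerHofstad2016NoBLE, §5.3.1 (5.36)–(5.38)] -/
theorem sumO4_le : (∑ i ∈ Icc 4 16, zO ^ i * qO i) ≤ QO4 := by
  simp only [sum_Icc_succ_top, Nat.reduceLeDiff, Icc_self, sum_singleton]
  norm_num [zO, qO, QO4]

/-- **Level `m = 4` with the folded literal:** `Σ'_y ‖y‖₂² P_p({0 ⟷_{≥4} y} □ {y ⟷ 0}) ≤ QO4 + (20 zO)^17 · γ 2 · c k` under the binders of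
`toReal_tsum_sq_weighted_repBubble_le_envelopeO_level`.  Pointer language only (input-certification instance at `d := 10`).
[cite: FitznerVanDerHofstad2016NoBLE, §5.3.1 (5.36)–(5.38) with §5.3.3 p. 1098; (5.14) p. 1092]
[cite: FitznerVanDerHofstad2017, §4.2 (4.18)] -/
theorem toReal_tsum_sq_weighted_repBubble_le_envelopeO_level4 {ι : Type*} [Fintype ι] [Nonempty ι]
    {p : unitInterval} (hp : p ∈ Set.Ioo (nbwThresholdI 10) (criticalProbI 10))
    {𝒮 : ι → ℕ × ℕ × Set (Site 10)} {cμ : ℝ} {c : ι → ℝ} (hc : ∀ k, 0 < c k)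
    {γ : Fin 3 → ℚ} (hΓ : ∀ i, nobleFOf 𝒮 cμ c i p ≤ (γ i : ℝ)) (hγ : γ 1 ≤ 119 / 100)
    {k : ι} (hk : 𝒮 k = (1, 17, {(0 : Site 10)})) (hpz : (p : ℝ) ≤ ((zO : ℚ) : ℝ)) :
    (∑' y : Site 10, ENNReal.ofReal (euclidNorm y ^ 2) *
        bondPercolation (zdGraph 10) p (openConnGe 4 (0 : Site 10) y □ openConn y 0)).toReal ≤
      ((QO4 : ℚ) : ℝ) + (2 * 10 * ((zO : ℚ) : ℝ)) ^ 17 * ((γ 2 : ℝ) * c k) := by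
  refine (toReal_tsum_sq_weighted_repBubble_le_envelopeO_level (m := 4) (by norm_num) hp hc hΓ hγ hk hpz).trans ?_
  have hs : (∑ i ∈ Icc 4 16, ((zO : ℚ) : ℝ) ^ i * ((qO i : ℚ) : ℝ)) ≤ ((QO4 : ℚ) : ℝ) := by
    have h1 := sumO4_le
    have h2 : ((∑ i ∈ Icc 4 16, zO ^ i * qO i : ℚ) : ℝ) = ∑ i ∈ Icc 4 16, ((zO : ℚ) : ℝ) ^ i * ((qO i : ℚ) : ℝ) := by
      push_cast; rfl
    rw [← h2]; exact_mod_cast h1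
  exact add_le_add hs le_rfl

/-- The folded literal `QO5 ≥ Σ_{i=5}^{16} zO^i · qO i`. [cite: FitznerVanDerHofstad2016NoBLE, §5.3.1 (5.36)–(5.38)] -/
def QO5 : ℚ := 9656796358633002227267894227259045892265 / 1000000000000000000000000000000000000000000

/-- `Σ_{i ∈ Icc 5 16} zO^i · qO i ≤ QO5` (exact rational arithmetic). [cite: FitznerVanDerHofstad2016NoBLE, §5.3.1 (5.36)–(5.38)] -/
theorem sumO5_le : (∑ i ∈ Icc 5 16, zO ^ i * qO i) ≤ QO5 := by
  simp only [sum_Icc_succ_top, Nat.reduceLeDiff, Icc_self, sum_singleton]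
  norm_num [zO, qO, QO5]

/-- **Level `m = 5` with the folded literal:** `Σ'_y ‖y‖₂² P_p({0 ⟷_{≥5} y} □ {y ⟷ 0}) ≤ QO5 + (20 zO)^17 · γ 2 · c k` under the binders of
`toReal_tsum_sq_weighted_repBubble_le_envelopeO_level`.  Pointer language only (input-certification instance at `d := 10`).
[cite: FitznerVanDerHofstad2016NoBLE, §5.3.1 (5.36)–(5.38) with §5.3.3 p. 1098; (5.14) p. 1092]
[cite: FitznerVanDerHofstad2017, §4.2 (4.18)] -/
theorem toReal_tsum_sq_weighted_repBubble_le_envelopeO_level5 {ι : Type*} [Fintype ι] [Nonempty ι]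
    {p : unitInterval} (hp : p ∈ Set.Ioo (nbwThresholdI 10) (criticalProbI 10))
    {𝒮 : ι → ℕ × ℕ × Set (Site 10)} {cμ : ℝ} {c : ι → ℝ} (hc : ∀ k, 0 < c k)
    {γ : Fin 3 → ℚ} (hΓ : ∀ i, nobleFOf 𝒮 cμ c i p ≤ (γ i : ℝ)) (hγ : γ 1 ≤ 119 / 100)
    {k : ι} (hk : 𝒮 k = (1, 17, {(0 : Site 10)})) (hpz : (p : ℝ) ≤ ((zO : ℚ) : ℝ)) :
    (∑' y : Site 10, ENNReal.ofReal (euclidNorm y ^ 2) *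
        bondPercolation (zdGraph 10) p (openConnGe 5 (0 : Site 10) y □ openConn y 0)).toReal ≤
      ((QO5 : ℚ) : ℝ) + (2 * 10 * ((zO : ℚ) : ℝ)) ^ 17 * ((γ 2 : ℝ) * c k) := by
  refine (toReal_tsum_sq_weighted_repBubble_le_envelopeO_level (m := 5) (by norm_num) hp hc hΓ hγ hk hpz).trans ?_
  have hs : (∑ i ∈ Icc 5 16, ((zO : ℚ) : ℝ) ^ i * ((qO i : ℚ) : ℝ)) ≤ ((QO5 : ℚ) : ℝ) := by
    have h1 := sumO5_le
    have h2 : ((∑ i ∈ Icc 5 16, zO ^ i * qO i : ℚ) : ℝ) = ∑ i ∈ Icc 5 16, ((zO : ℚ) : ℝ) ^ i * ((qO i : ℚ) : ℝ) := by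
      push_cast; rfl
    rw [← h2]; exact_mod_cast h1
  exact add_le_add hs le_rfl

/-- The folded literal `QO6 ≥ Σ_{i=6}^{16} zO^i · qO i`. [cite: FitznerVanDerHofstad2016NoBLE, §5.3.1 (5.36)–(5.38)] -/
def QO6 : ℚ := 7400266779496569638824329779968453618045 / 1000000000000000000000000000000000000000000

/-- `Σ_{i ∈ Icc 6 16} zO^i · qO i ≤ QO6` (exact rational arithmetic). [cite: FitznerVanDerHofstad2016NoBLE, §5.3.1 (5.36)–(5.38)] -/
theorem sumO6_le : (∑ i ∈ Icc 6 16, zO ^ i * qO i) ≤ QO6 := by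
  simp only [sum_Icc_succ_top, Nat.reduceLeDiff, Icc_self, sum_singleton]
  norm_num [zO, qO, QO6]

/-- **Level `m = 6` with the folded literal:** `Σ'_y ‖y‖₂² P_p({0 ⟷_{≥6} y} □ {y ⟷ 0}) ≤ QO6 + (20 zO)^17 · γ 2 · c k` under the binders of
`toReal_tsum_sq_weighted_repBubble_le_envelopeO_level`.  Pointer language only (input-certification instance at `d := 10`).
[cite: FitznerVanDerHofstad2016NoBLE, §5.3.1 (5.36)–(5.38) with §5.3.3 p. 1098; (5.14) p. 1092]
[cite: FitznerVanDerHofstad2017, §4.2 (4.18)] -/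
theorem toReal_tsum_sq_weighted_repBubble_le_envelopeO_level6 {ι : Type*} [Fintype ι] [Nonempty ι]
    {p : unitInterval} (hp : p ∈ Set.Ioo (nbwThresholdI 10) (criticalProbI 10))
    {𝒮 : ι → ℕ × ℕ × Set (Site 10)} {cμ : ℝ} {c : ι → ℝ} (hc : ∀ k, 0 < c k)
    {γ : Fin 3 → ℚ} (hΓ : ∀ i, nobleFOf 𝒮 cμ c i p ≤ (γ i : ℝ)) (hγ : γ 1 ≤ 119 / 100)
    {k : ι} (hk : 𝒮 k = (1, 17, {(0 : Site 10)})) (hpz : (p : ℝ) ≤ ((zO : ℚ) : ℝ)) :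
    (∑' y : Site 10, ENNReal.ofReal (euclidNorm y ^ 2) *
        bondPercolation (zdGraph 10) p (openConnGe 6 (0 : Site 10) y □ openConn y 0)).toReal ≤
      ((QO6 : ℚ) : ℝ) + (2 * 10 * ((zO : ℚ) : ℝ)) ^ 17 * ((γ 2 : ℝ) * c k) := by
  refine (toReal_tsum_sq_weighted_repBubble_le_envelopeO_level (m := 6) (by norm_num) hp hc hΓ hγ hk hpz).trans ?_
  have hs : (∑ i ∈ Icc 6 16, ((zO : ℚ) : ℝ) ^ i * ((qO i : ℚ) : ℝ)) ≤ ((QO6 : ℚ) : ℝ) := by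
    have h1 := sumO6_le
    have h2 : ((∑ i ∈ Icc 6 16, zO ^ i * qO i : ℚ) : ℝ) = ∑ i ∈ Icc 6 16, ((zO : ℚ) : ℝ) ^ i * ((qO i : ℚ) : ℝ) := by
      push_cast; rfl
    rw [← h2]; exact_mod_cast h1
  exact add_le_add hs le_rfl

end WbxCellD10

end Literature.Probability.FitznerVanDerHofstad2017
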